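import Summits.PneNP.PneNP.Theorems.ConvexRankGatesConvexGateBlindExactLiftingTriangleLineVC

/-!
# The triangle instance: cover lemma, confinement, and the count of monochromatic triangles

Support file for crux `ConvexGateBlind` (stmt-PneNP-10680), line `xor-door-perfect-completeness`, open
stub `stub_exactLifting` (prover seat 0, session 20; memo ANALYSIS10; second of three files
`…TriangleLineVC` ⟵ this ⟵ `…TriangleLine`).

THE INSTANCE (seat 3 / lead c5's minimal test object). Blocks `1,2,3` of `t` vertices each; a transversal
triangle is `w = (a,b,d) ∈ Tri t = Fin t × Fin t × Fin t`; a `2`-colouring is `x ∈ Col t = (Fin t → Bool)³`;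
`monoCount x w ∈ {1,3}` is the number of monochromatic edges of `w` — the matrix
`M_t[x,w] = 1 + 2·[x₁ a = x₂ b = x₃ d]` (rank `3t²−3t+1`, `rk₊ ≤ 3t²` by the `3t²` junta lines,
`rk₊(M_t − J) = t³`; its strict rank is the open question of record).

THE LINE MODEL. A column factor `v : Tri t → ℝ` is line-supported if it vanishes off one junta line
(`OnLine v L`, `L : Line t` = a cell of one of the three vertex-pairs). Given an assignment `asg` of terms to
lines, the row-`x` identity `M_t[x,·] − ε = ∑_l u_l v_l + ∑_j α_j β_j` splits along the three lines through
each triangle into PROFILES `p12, p13, p23` (`sum_eq_p12_add_p13_add_p23`, `RowFact`).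

* CONFINEMENT (`isMono_of_mem_U12/13/23`): where a profile exceeds the threshold
  `θ = 1 − ε − ∑_j α_j β_j` (the level sets `U12 a b`, …), the triangle is monochromatic — on a
  `1`-mono triangle the whole row is `1 − ε`.
* COVER (`cover`, `card_mono_le`): at a monochromatic triangle the three profiles sum to `3 − ε − ∑αβ >
  3θ`, so one of them exceeds `θ`; hence `#Mono_x ≤ ∑_{ab} #U12 + ∑_{ad} #U13 + ∑_{bd} #U23`.
* COUNTING (`four_mul_sum_card_mono`, registered form `triangle_mono_count`):
  `4 · ∑_x #Mono_x = t³ · 8^t`, via the colour classes `cls y s` of one block and the involutions `y ↦ ¬y`.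
-/

set_option linter.dupNamespace false -- `Summit.PneNP.PneNP.…`: summit = sub-problem (D-0017)

namespace Summit.PneNP.PneNP.Theorems.XorDoor.TriLine

open Finset

noncomputable section

/-! ## The triangle instance and the line model -/

/-- Transversal triangles of `K_{t,t,t}`: one vertex `(a, b, d)` in each of the three blocks. -/
abbrev Tri (t : ℕ) := Fin t × Fin t × Fin t

/-- `2`-colourings of the three blocks. -/
abbrev Col (t : ℕ) := (Fin t → Bool) × (Fin t → Bool) × (Fin t → Bool)

/-- The number of monochromatic edges of the triangle `w` under the colouring `x` (it is `1` or `3`); as a real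
matrix indexed by `Col t × Tri t` this is seat 3's minimal instance `M_t = 1 + 2·[x₁(w₁) = x₂(w₂) = x₃(w₃)]`. -/
def monoCount {t : ℕ} (x : Col t) (w : Tri t) : ℕ :=
  (if x.1 w.1 = x.2.1 w.2.1 then 1 else 0) + (if x.1 w.1 = x.2.2 w.2.2 then 1 else 0) +
    (if x.2.1 w.2.1 = x.2.2 w.2.2 then 1 else 0)

/-- The triangle `(a, b, d)` is monochromatic under `x`. -/
def IsMono {t : ℕ} (x : Col t) (a b d : Fin t) : Prop := x.1 a = x.2.1 b ∧ x.1 a = x.2.2 d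

/-- monochromaticity is decidable -/
instance {t : ℕ} (x : Col t) (a b d : Fin t) : Decidable (IsMono x a b d) := by
  unfold IsMono; infer_instance

/-- a monochromatic triangle has `3` monochromatic edges -/
lemma monoCount_of_isMono {t : ℕ} {x : Col t} {a b d : Fin t} (h : IsMono x a b d) :
    monoCount x (a, b, d) = 3 := by
  obtain ⟨h1, h2⟩ := h
  simp only [monoCount]
  rw [if_pos h1, if_pos h2, if_pos (h1.symm.trans h2)]

/-- a non-monochromatic triangle has exactly `1` monochromatic edge (pigeonhole on two colours) -/
lemma monoCount_of_not_isMono {t : ℕ} {x : Col t} {a b d : Fin t} (h : ¬ IsMono x a b d) :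
    monoCount x (a, b, d) = 1 := by
  unfold IsMono at h
  unfold monoCount
  rcases Bool.eq_false_or_eq_true (x.1 a) with h1 | h1 <;>
  rcases Bool.eq_false_or_eq_true (x.2.1 b) with h2 | h2 <;>
  rcases Bool.eq_false_or_eq_true (x.2.2 d) with h3 | h3 <;>
  simp_all

/-! ### A line-supported factorisation, one colouring at a time -/

section OneRow

variable {t R q : ℕ}

/-- The line of a line-supported column factor: `inl (a,b)` = `{(a,b,·)}`, `inr (inl (a,d))` = `{(a,·,d)}`,
`inr (inr (b,d))` = `{(·,b,d)}`. -/
abbrev Line (t : ℕ) := (Fin t × Fin t) ⊕ (Fin t × Fin t) ⊕ (Fin t × Fin t)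

/-- `v` vanishes off the line `L`. -/
def OnLine {t : ℕ} (v : Tri t → ℝ) : Line t → Prop
  | Sum.inl (a, b) => ∀ w, v w ≠ 0 → w.1 = a ∧ w.2.1 = b
  | Sum.inr (Sum.inl (a, d)) => ∀ w, v w ≠ 0 → w.1 = a ∧ w.2.2 = d
  | Sum.inr (Sum.inr (b, d)) => ∀ w, v w ≠ 0 → w.2.1 = b ∧ w.2.2 = d

variable (v : Fin R → Tri t → ℝ) (asg : Fin R → Line t)

/-- profile of the terms assigned to the line `{(a,b,·)}`, for the row `x` -/
def p12 (u : Fin R → ℝ) (a b : Fin t) (d : Fin t) : ℝ :=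
  ∑ l, if asg l = Sum.inl (a, b) then u l * v l (a, b, d) else 0

/-- profile of the terms assigned to the line `{(a,·,d)}` -/
def p13 (u : Fin R → ℝ) (a d : Fin t) (b : Fin t) : ℝ :=
  ∑ l, if asg l = Sum.inr (Sum.inl (a, d)) then u l * v l (a, b, d) else 0

/-- profile of the terms assigned to the line `{(·,b,d)}` -/
def p23 (u : Fin R → ℝ) (b d : Fin t) (a : Fin t) : ℝ :=
  ∑ l, if asg l = Sum.inr (Sum.inr (b, d)) then u l * v l (a, b, d) else 0

variable {v asg}

/-- Splitting `∑_l u_l v_l(a,b,d)` along the three lines through `(a,b,d)`. -/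
lemma sum_eq_p12_add_p13_add_p23 (hasg : ∀ l, OnLine (v l) (asg l)) (u : Fin R → ℝ) (a b d : Fin t) :
    ∑ l, u l * v l (a, b, d) = p12 v asg u a b d + p13 v asg u a d b + p23 v asg u b d a := by
  unfold p12 p13 p23
  rw [← sum_add_distrib, ← sum_add_distrib]
  refine sum_congr rfl fun l _ => ?_
  by_cases hv : v l (a, b, d) = 0
  · simp [hv]
  · have hl := hasg l
    -- the assigned line of `l` passes through `(a,b,d)`
    rcases h : asg l with ⟨a', b'⟩ | ⟨a', d'⟩ | ⟨b', d'⟩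
    · rw [h] at hl
      obtain ⟨rfl, rfl⟩ := hl (a, b, d) hv
      simp
    · rw [h] at hl
      obtain ⟨rfl, rfl⟩ := hl (a, b, d) hv
      simp
    · rw [h] at hl
      obtain ⟨rfl, rfl⟩ := hl (a, b, d) hv
      simp

/-- threshold `θ(w) = 1 − ε − ∑_j α_j β_j(w)` -/
def thr (ε : ℝ) (α : Fin q → ℝ) (β : Fin q → Tri t → ℝ) (w : Tri t) : ℝ := 1 - ε - ∑ j, α j * β j w

/-- upper level set of the `(a,b)`-profile above the threshold -/
def U12 (ε : ℝ) (u : Fin R → ℝ) (α : Fin q → ℝ) (β : Fin q → Tri t → ℝ) (a b : Fin t) : Finset (Fin t) :=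
  posSet fun d => p12 v asg u a b d - thr ε α β (a, b, d)

/-- upper level set of the `(a,d)`-profile above the threshold -/
def U13 (ε : ℝ) (u : Fin R → ℝ) (α : Fin q → ℝ) (β : Fin q → Tri t → ℝ) (a d : Fin t) : Finset (Fin t) :=
  posSet fun b => p13 v asg u a d b - thr ε α β (a, b, d)

/-- upper level set of the `(b,d)`-profile above the threshold -/
def U23 (ε : ℝ) (u : Fin R → ℝ) (α : Fin q → ℝ) (β : Fin q → Tri t → ℝ) (b d : Fin t) : Finset (Fin t) :=
  posSet fun a => p23 v asg u b d a - thr ε α β (a, b, d)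

/-- Row hypothesis: the factorisation identity for the row `x`, split along lines. -/
def RowFact (v : Fin R → Tri t → ℝ) (asg : Fin R → Line t) (ε : ℝ) (x : Col t) (u : Fin R → ℝ)
    (α : Fin q → ℝ) (β : Fin q → Tri t → ℝ) : Prop :=
  ∀ a b d : Fin t, (monoCount x (a, b, d) : ℝ) - ε
    = p12 v asg u a b d + p13 v asg u a d b + p23 v asg u b d a + ∑ j, α j * β j (a, b, d)

variable {ε : ℝ} {x : Col t} {u : Fin R → ℝ} {α : Fin q → ℝ} {β : Fin q → Tri t → ℝ}

/-- CONFINEMENT: a point of `U12 a b` closes a monochromatic triangle. -/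
lemma isMono_of_mem_U12 (hrow : RowFact v asg ε x u α β) (hp13 : ∀ a d b, 0 ≤ p13 v asg u a d b)
    (hp23 : ∀ b d a, 0 ≤ p23 v asg u b d a) {a b d : Fin t}
    (h : d ∈ U12 (v := v) (asg := asg) ε u α β a b) : IsMono x a b d := by
  by_contra hm
  have h1 := hrow a b d
  rw [monoCount_of_not_isMono hm] at h1
  rw [U12, mem_posSet] at h
  unfold thr at h
  have := hp13 a d b
  have := hp23 b d a
  push_cast at h1
  linarith

/-- CONFINEMENT for `U13`. -/
lemma isMono_of_mem_U13 (hrow : RowFact v asg ε x u α β) (hp12 : ∀ a b d, 0 ≤ p12 v asg u a b d)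
    (hp23 : ∀ b d a, 0 ≤ p23 v asg u b d a) {a b d : Fin t}
    (h : b ∈ U13 (v := v) (asg := asg) ε u α β a d) : IsMono x a b d := by
  by_contra hm
  have h1 := hrow a b d
  rw [monoCount_of_not_isMono hm] at h1
  rw [U13, mem_posSet] at h
  unfold thr at h
  have := hp12 a b d
  have := hp23 b d a
  push_cast at h1
  linarith

/-- CONFINEMENT for `U23`. -/
lemma isMono_of_mem_U23 (hrow : RowFact v asg ε x u α β) (hp12 : ∀ a b d, 0 ≤ p12 v asg u a b d)
    (hp13 : ∀ a d b, 0 ≤ p13 v asg u a d b) {a b d : Fin t}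
    (h : a ∈ U23 (v := v) (asg := asg) ε u α β b d) : IsMono x a b d := by
  by_contra hm
  have h1 := hrow a b d
  rw [monoCount_of_not_isMono hm] at h1
  rw [U23, mem_posSet] at h
  unfold thr at h
  have := hp12 a b d
  have := hp13 a d b
  push_cast at h1
  linarith

/-- COVER: at a monochromatic triangle one of the three profiles exceeds its threshold (`ε > 0`, free terms
`≥ 0`). -/
lemma cover (hrow : RowFact v asg ε x u α β) (hε : 0 < ε) (hfree : ∀ w, 0 ≤ ∑ j, α j * β j w)
    {a b d : Fin t} (hm : IsMono x a b d) :
    d ∈ U12 (v := v) (asg := asg) ε u α β a b ∨ b ∈ U13 (v := v) (asg := asg) ε u α β a d ∨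
      a ∈ U23 (v := v) (asg := asg) ε u α β b d := by
  by_contra h
  simp only [not_or, U12, U13, U23, mem_posSet, not_lt, thr] at h
  obtain ⟨h₁, h₂, h₃⟩ := h
  have h1 := hrow a b d
  rw [monoCount_of_isMono hm] at h1
  have h0 := hfree (a, b, d)
  push_cast at h1
  linarith

/-- COVER COUNT: `#Mono_x ≤ ∑_{ab} #U12 + ∑_{ad} #U13 + ∑_{bd} #U23`. -/
lemma card_mono_le (hrow : RowFact v asg ε x u α β) (hε : 0 < ε) (hfree : ∀ w, 0 ≤ ∑ j, α j * β j w) :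
    #(univ.filter fun w : Tri t => IsMono x w.1 w.2.1 w.2.2)
      ≤ ∑ ab : Fin t × Fin t, #(U12 (v := v) (asg := asg) ε u α β ab.1 ab.2)
        + ∑ ad : Fin t × Fin t, #(U13 (v := v) (asg := asg) ε u α β ad.1 ad.2)
        + ∑ bd : Fin t × Fin t, #(U23 (v := v) (asg := asg) ε u α β bd.1 bd.2) := by
  classical
  set A := (univ : Finset (Fin t × Fin t)).biUnion fun ab =>
    (U12 (v := v) (asg := asg) ε u α β ab.1 ab.2).map ⟨fun d => (ab.1, ab.2, d), fun d d' h => by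
      simpa using h⟩ with hA
  set B := (univ : Finset (Fin t × Fin t)).biUnion fun ad =>
    (U13 (v := v) (asg := asg) ε u α β ad.1 ad.2).map ⟨fun b => (ad.1, b, ad.2), fun d d' h => by
      simpa using h⟩ with hB
  set C := (univ : Finset (Fin t × Fin t)).biUnion fun bd =>
    (U23 (v := v) (asg := asg) ε u α β bd.1 bd.2).map ⟨fun a => (a, bd.1, bd.2), fun d d' h => by
      simpa using h⟩ with hC
  have hsub : (univ.filter fun w : Tri t => IsMono x w.1 w.2.1 w.2.2) ⊆ A ∪ B ∪ C := by
    intro w hw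
    obtain ⟨a, b, d⟩ := w
    simp only [mem_filter, mem_univ, true_and] at hw
    rcases cover (v := v) (asg := asg) hrow hε hfree hw with h | h | h
    · refine mem_union_left _ (mem_union_left _ ?_)
      rw [hA, mem_biUnion]
      exact ⟨(a, b), mem_univ _, mem_map.2 ⟨d, h, rfl⟩⟩
    · refine mem_union_left _ (mem_union_right _ ?_)
      rw [hB, mem_biUnion]
      exact ⟨(a, d), mem_univ _, mem_map.2 ⟨b, h, rfl⟩⟩
    · refine mem_union_right _ ?_
      rw [hC, mem_biUnion]
      exact ⟨(b, d), mem_univ _, mem_map.2 ⟨a, h, rfl⟩⟩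
  have hAc : #A ≤ ∑ ab : Fin t × Fin t, #(U12 (v := v) (asg := asg) ε u α β ab.1 ab.2) := by
    rw [hA]; refine card_biUnion_le.trans ?_; simp
  have hBc : #B ≤ ∑ ad : Fin t × Fin t, #(U13 (v := v) (asg := asg) ε u α β ad.1 ad.2) := by
    rw [hB]; refine card_biUnion_le.trans ?_; simp
  have hCc : #C ≤ ∑ bd : Fin t × Fin t, #(U23 (v := v) (asg := asg) ε u α β bd.1 bd.2) := by
    rw [hC]; refine card_biUnion_le.trans ?_; simp
  calc #(univ.filter fun w : Tri t => IsMono x w.1 w.2.1 w.2.2) ≤ #(A ∪ B ∪ C) := card_le_card hsub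
    _ ≤ #A + #B + #C := (card_union_le _ _).trans (Nat.add_le_add_right (card_union_le _ _) _)
    _ ≤ _ := by omega

end OneRow

/-! ### Colour classes; sums over the colourings of one block -/

/-- The colour class of `s` under the block colouring `y`. -/
def cls {t : ℕ} (y : Fin t → Bool) (s : Bool) : Finset (Fin t) := univ.filter fun d => y d = s

/-- membership in a colour class -/
@[simp] lemma mem_cls {t : ℕ} {y : Fin t → Bool} {s : Bool} {d : Fin t} : d ∈ cls y s ↔ y d = s := by
  simp [cls]

/-- for fixed `s`, `y ↦ cls y s` is a bijection from block colourings onto subsets of the block -/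
lemma cls_bijective {t : ℕ} (s : Bool) : Function.Bijective fun y : Fin t → Bool => cls y s := by
  constructor
  · intro y y' h
    funext d
    have h' : d ∈ cls y s ↔ d ∈ cls y' s := by simp only at h; rw [h]
    simp only [mem_cls] at h'
    cases hy : y d <;> cases hy' : y' d <;> cases s <;> simp_all
  · intro C
    refine ⟨fun d => if d ∈ C then s else !s, ?_⟩
    ext d
    by_cases hd : d ∈ C <;> simp [hd]

/-- the averaging lemma transported to colourings: `∑_y maxIn F (cls y s) ≤ 2^t (k+1)` -/
lemma sum_maxIn_cls_le {t k : ℕ} (F : Finset (Finset (Fin t))) (hF : #F ≤ 2 ^ k) (s : Bool) :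
    ∑ y : Fin t → Bool, maxIn F (cls y s) ≤ 2 ^ t * (k + 1) :=
  calc ∑ y : Fin t → Bool, maxIn F (cls y s) = ∑ C : Finset (Fin t), maxIn F C :=
        Fintype.sum_bijective _ (cls_bijective s) _ _ fun _ => rfl
    _ ≤ 2 ^ t * (k + 1) := sum_maxIn_le F hF

/-- the two colour classes partition the block -/
lemma card_cls_add_card_cls_not {t : ℕ} (y : Fin t → Bool) (s : Bool) :
    #(cls y s) + #(cls y (!s)) = t := by
  have h : cls y (!s) = univ \ cls y s := by
    ext d
    simp only [mem_cls, mem_sdiff, mem_univ, true_and]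
    cases y d <;> cases s <;> simp
  rw [h, card_sdiff_of_subset (subset_univ _), card_univ, Fintype.card_fin, Nat.add_sub_cancel']
  exact (card_le_univ _).trans_eq (Fintype.card_fin t)

/-- `2 ∑_y #(cls y s) = t 2^t` (the involution `y ↦ ¬y`) -/
lemma two_mul_sum_card_cls {t : ℕ} (s : Bool) :
    2 * ∑ y : Fin t → Bool, #(cls y s) = t * 2 ^ t := by
  have h1 : ∑ y : Fin t → Bool, #(cls y s) = ∑ y : Fin t → Bool, #(cls y (!s)) := by
    refine Fintype.sum_bijective (fun y d => !y d)
      (Function.Involutive.bijective fun y => by funext d; simp) _ _ fun y => ?_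
    congr 1
    ext d
    simp only [mem_cls]
    cases y d <;> cases s <;> simp
  calc 2 * ∑ y : Fin t → Bool, #(cls y s)
      = ∑ y : Fin t → Bool, #(cls y s) + ∑ y : Fin t → Bool, #(cls y (!s)) := by rw [two_mul, h1]
    _ = ∑ y : Fin t → Bool, (#(cls y s) + #(cls y (!s))) := sum_add_distrib.symm
    _ = ∑ y : Fin t → Bool, t := sum_congr rfl fun y _ => card_cls_add_card_cls_not y s
    _ = t * 2 ^ t := by simp [mul_comm]

/-- `∑_y #(cls y s)` does not depend on `s` -/
lemma sum_card_cls_eq {t : ℕ} (s : Bool) :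
    ∑ y : Fin t → Bool, #(cls y s) = ∑ y : Fin t → Bool, #(cls y true) := by
  have := two_mul_sum_card_cls (t := t) s
  have := two_mul_sum_card_cls (t := t) true
  omega

/-- `2 · #{(x₁,x₂) : x₁ a = x₂ b} = 4^t` (the involution `x₂ ↦ ¬x₂`) -/
lemma two_mul_sum_agree {t : ℕ} (a b : Fin t) :
    2 * ∑ x12 : (Fin t → Bool) × (Fin t → Bool), (if x12.1 a = x12.2 b then 1 else 0) = 2 ^ t * 2 ^ t := by
  have h1 : ∑ x12 : (Fin t → Bool) × (Fin t → Bool), (if x12.1 a = x12.2 b then 1 else 0)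
      = ∑ x12 : (Fin t → Bool) × (Fin t → Bool), (if x12.1 a = !x12.2 b then 1 else 0) := by
    refine Fintype.sum_bijective (fun x12 => (x12.1, fun d => !x12.2 d))
      (Function.Involutive.bijective fun x12 => by simp) _ _ fun x12 => ?_
    simp
  calc 2 * ∑ x12 : (Fin t → Bool) × (Fin t → Bool), (if x12.1 a = x12.2 b then 1 else 0)
      = ∑ x12 : (Fin t → Bool) × (Fin t → Bool),
          ((if x12.1 a = x12.2 b then 1 else 0) + (if x12.1 a = !x12.2 b then 1 else 0)) := by
        rw [two_mul, sum_add_distrib, ← h1]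
    _ = ∑ x12 : (Fin t → Bool) × (Fin t → Bool), 1 := by
        refine sum_congr rfl fun x12 _ => ?_
        cases x12.1 a <;> cases x12.2 b <;> simp
    _ = 2 ^ t * 2 ^ t := by simp

/-! ### Counting monochromatic triangles over all colourings -/

/-- the monochromatic triangles on the line `{(a,b,·)}` -/
lemma card_mono_line {t : ℕ} (x : Col t) (a b : Fin t) :
    #(univ.filter fun d => IsMono x a b d) = if x.1 a = x.2.1 b then #(cls x.2.2 (x.1 a)) else 0 := by
  split_ifs with h
  · congr 1
    ext d
    simp [IsMono, h, cls, eq_comm]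
  · rw [card_eq_zero, filter_eq_empty_iff]
    intro d _ hm
    exact h hm.1

/-- `4 ∑_x #{d : (a,b,d) monochromatic under x} = t · 8^t` -/
lemma four_mul_sum_card_mono_line {t : ℕ} (a b : Fin t) :
    4 * ∑ x : Col t, #(univ.filter fun d => IsMono x a b d) = t * (2 ^ t * 2 ^ t * 2 ^ t) := by
  have hA := two_mul_sum_card_cls (t := t) true
  have hB := two_mul_sum_agree a b
  have key : ∑ x : Col t, #(univ.filter fun d => IsMono x a b d)
      = (∑ x12 : (Fin t → Bool) × (Fin t → Bool), (if x12.1 a = x12.2 b then 1 else 0))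
          * ∑ y : Fin t → Bool, #(cls y true) := by
    simp only [card_mono_line, Fintype.sum_prod_type, sum_mul]
    refine sum_congr rfl fun x1 _ => sum_congr rfl fun x2 _ => ?_
    split_ifs with h
    · simp only [one_mul]
      exact sum_card_cls_eq (x1 a)
    · simp
  rw [key]
  calc 4 * ((∑ x12 : (Fin t → Bool) × (Fin t → Bool), (if x12.1 a = x12.2 b then 1 else 0))
          * ∑ y : Fin t → Bool, #(cls y true))
      = (2 * ∑ x12 : (Fin t → Bool) × (Fin t → Bool), (if x12.1 a = x12.2 b then 1 else 0))
          * (2 * ∑ y : Fin t → Bool, #(cls y true)) := by ring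
    _ = t * (2 ^ t * 2 ^ t * 2 ^ t) := by rw [hA, hB]; ring

/-- the monochromatic triangles counted line by line -/
lemma card_mono_eq_sum {t : ℕ} (x : Col t) :
    #(univ.filter fun w : Tri t => IsMono x w.1 w.2.1 w.2.2)
      = ∑ ab : Fin t × Fin t, #(univ.filter fun d => IsMono x ab.1 ab.2 d) := by
  simp only [card_filter, Fintype.sum_prod_type]

/-- `4 ∑_x #Mono_x = t³ · 8^t`: each triangle is monochromatic under a quarter of the colourings -/
lemma four_mul_sum_card_mono {t : ℕ} :
    4 * ∑ x : Col t, #(univ.filter fun w : Tri t => IsMono x w.1 w.2.1 w.2.2)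
      = t ^ 3 * (2 ^ t * 2 ^ t * 2 ^ t) := by
  simp only [card_mono_eq_sum]
  rw [sum_comm, mul_sum]
  simp only [four_mul_sum_card_mono_line, sum_const, card_univ, Fintype.card_prod, Fintype.card_fin,
    smul_eq_mul]
  ring


/-- **Count of monochromatic transversal triangles over all `2`-colourings** — registered sub-goal
`triangle_mono_count` of stmt-PneNP-10680, verbatim signature (see `four_mul_sum_card_mono`). -/
theorem triangle_mono_count :
    ∀ t : ℕ, 4 * ∑ x : (Fin t → Bool) × (Fin t → Bool) × (Fin t → Bool), (Finset.univ.filter fun w :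
    Fin t × Fin t × Fin t => x.1 w.1 = x.2.1 w.2.1 ∧ x.1 w.1 = x.2.2 w.2.2).card = t ^ 3 * (2 ^ t * 2 ^ t *
    2 ^ t) :=
  fun t => four_mul_sum_card_mono (t := t)

end

end Summit.PneNP.PneNP.Theorems.XorDoor.TriLine
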